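import Summits.AtomisticToContinuum.HydrodynamicLimit.Theses.JParityClosure
import Literature.MathematicalPhysics.KineticTheory.HardSphereEulerProofs
import Mathlib.MeasureTheory.Integral.Marginal
import HarnessLib

/-!
# Exponential moment of the flux-tilted Maxwellian pair (K1d of P4)

Crux `JParityClosure.OddContactSymmetry` (stmt-AtomisticToContinuum-17722), line `KineticSlabSketch`,
registered stub `stub_tiltedPairExpMoment`: on the product Gaussian space `(ℝ³)ⁿ` with i.i.d.
centred Maxwellian coordinates of temperature `θ`, for `i ≠ j`, a direction `ω` and a tilt
`c < 1/(2θ)`,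
`∫ (ω·(vᵢ−vⱼ))₊ e^{c(|vᵢ|²+|vⱼ|²)} dγ_θ^{⊗n} = (1 − 2cθ)^{-7/2} ∫ (ω·(vᵢ−vⱼ))₊ dγ_θ^{⊗n}`.

Proof (an exact scaling identity). Put `s = 1 − 2cθ ∈ (0, ∞)` and `θ' = θ/s`.
* Density rewrite on one coordinate: `M_{1,0,θ}(a) e^{c|a|²} = s^{-3/2} M_{1,0,θ'}(a)` pointwise, hence
  `γ_θ` with density `e^{c|·|²}` is `s^{-3/2} γ_{θ'}` (`withDensity_localMaxwellian_eq_gaussMeasure`).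
* Scaling: `γ_{θ'}` is the image of `γ_θ` under `a ↦ s^{-1/2} a`, and `(ω·(λa−λb))₊ = λ (ω·(a−b))₊`.
* Only the coordinates `i, j` enter: both sides reduce to iterated integrals over `γ_θ ⊗ γ_θ`
  (`lmarginal` over `{i, j}`, the other coordinates having unit mass), and
  `s^{-3/2} · s^{-3/2} · s^{-1/2} = s^{-7/2}`.
-/

noncomputable section

open scoped BigOperators Classical InnerProductSpace ENNReal Topology
open Set MeasureTheory Filter
open Literature.Analysis.FluidPDE Literature.MathematicalPhysics.KineticTheory

namespace Summit.AtomisticToContinuum.HydrodynamicLimit.Theorems.OddContactSymmetryKineticSlab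

/-! ### One-coordinate Gaussian calculus -/

/-- The tilt parameter is admissible: `c < 1/(2θ)` gives `0 < 1 − 2cθ`. [folklore] -/
theorem one_sub_two_mul_tilt_pos {θ c : ℝ} (hθ : 0 < θ) (hcθ : c < 1 / (2 * θ)) : 0 < 1 - 2 * c * θ := by
  have h2θ : 0 < 2 * θ := by positivity
  rw [lt_div_iff₀ h2θ] at hcθ
  nlinarith

/-- **Density rewrite.** Tilting the centred Maxwellian of temperature `θ` by `e^{c|a|²}`
(`c < 1/(2θ)`) gives `(1 − 2cθ)^{-3/2}` times the centred Maxwellian of temperature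
`θ / (1 − 2cθ)` (complete the square; `dim = 3`). [folklore] -/
theorem localMaxwellian_mul_exp_tilt {θ c : ℝ} (hθ : 0 < θ) (hcθ : c < 1 / (2 * θ)) (a : V3) :
    localMaxwellian 1 θ 0 a * Real.exp (c * ‖a‖ ^ 2) =
      (1 - 2 * c * θ) ^ (-(3 : ℝ) / 2) * localMaxwellian 1 (θ / (1 - 2 * c * θ)) 0 a := by
  have hs : 0 < 1 - 2 * c * θ := one_sub_two_mul_tilt_pos hθ hcθ
  set s := 1 - 2 * c * θ with hs_def
  have hfin : (Module.finrank ℝ V3 : ℝ) = 3 := by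
    rw [finrank_euclideanSpace_fin]; norm_num
  simp only [localMaxwellian, hfin, sub_zero, one_mul]
  have hpref : s ^ (-(3 : ℝ) / 2) * (2 * Real.pi * (θ / s)) ^ (-(3 : ℝ) / 2) =
      (2 * Real.pi * θ) ^ (-(3 : ℝ) / 2) := by
    rw [mul_div_assoc', Real.div_rpow (by positivity) hs.le,
      mul_div_cancel₀ _ (Real.rpow_pos_of_pos hs _).ne']
  rw [mul_assoc, ← Real.exp_add, ← hpref, mul_assoc]
  congr 2
  rw [hs_def]
  field_simp
  ring

/-- **Tilted Gaussian law.** `e^{c|a|²} γ_θ(da) = (1 − 2cθ)^{-3/2} γ_{θ/(1−2cθ)}(da)` as measures on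
`ℝ³` (`c < 1/(2θ)`). [folklore] -/
theorem withDensity_exp_tilt_gaussMeasure {θ c : ℝ} (hθ : 0 < θ) (hcθ : c < 1 / (2 * θ)) :
    (gaussMeasure (0 : V3) θ).withDensity (fun a => ENNReal.ofReal (Real.exp (c * ‖a‖ ^ 2))) =
      ENNReal.ofReal ((1 - 2 * c * θ) ^ (-(3 : ℝ) / 2)) •
        gaussMeasure (0 : V3) (θ / (1 - 2 * c * θ)) := by
  have hs : 0 < 1 - 2 * c * θ := one_sub_two_mul_tilt_pos hθ hcθ
  have hθ' : 0 < θ / (1 - 2 * c * θ) := div_pos hθ hs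
  rw [← withDensity_localMaxwellian_eq_gaussMeasure hθ 0,
    ← withDensity_localMaxwellian_eq_gaussMeasure hθ' 0,
    ← withDensity_mul _ (continuous_localMaxwellian 1 θ (0 : V3)).measurable.ennreal_ofReal
      (by fun_prop),
    ← withDensity_smul _ (continuous_localMaxwellian 1 _ (0 : V3)).measurable.ennreal_ofReal]
  congr 1
  funext a
  simp only [Pi.mul_apply, Pi.smul_apply, smul_eq_mul]
  rw [← ENNReal.ofReal_mul (localMaxwellian_nonneg zero_le_one hθ.le (0 : V3) a),
    ← ENNReal.ofReal_mul (Real.rpow_nonneg hs.le _), localMaxwellian_mul_exp_tilt hθ hcθ a]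

/-- **Scaling of the centred Gaussian law.** `γ_{θ/s}` is the image of `γ_θ` under `a ↦ s^{-1/2} a`
(`θ ≥ 0`, `s > 0`). [folklore] -/
theorem gaussMeasure_div_eq_map_smul {θ s : ℝ} (hs : 0 < s) :
    gaussMeasure (0 : V3) (θ / s) = (gaussMeasure (0 : V3) θ).map (fun a => (Real.sqrt s)⁻¹ • a) := by
  unfold gaussMeasure
  rw [Measure.map_map (by fun_prop) (measurable_gaussShift 0 θ)]
  congr 1
  funext w
  simp only [Function.comp_apply, zero_add, smul_smul]
  rw [Real.sqrt_div' θ hs.le, div_eq_inv_mul]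

/-! ### Two coordinates of a finite product of probability measures -/

/-- A function of two distinct coordinates integrates over a finite power of a probability measure
as the iterated integral over those two coordinates (Tonelli via `lmarginal` over `{i, j}`; the
other coordinates have unit mass). [folklore] -/
theorem lintegral_pi_pair_iterated {α : Type*} [MeasurableSpace α] (μ : Measure α) [IsProbabilityMeasure μ]
    {n : ℕ} {i j : Fin n} (hij : i ≠ j) {g : α → α → ℝ≥0∞}
    (hg : Measurable fun p : α × α => g p.1 p.2) :
    ∫⁻ v, g (v i) (v j) ∂Measure.pi (fun _ : Fin n => μ) = ∫⁻ a, ∫⁻ b, g a b ∂μ ∂μ := by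
  set K := ∫⁻ a, ∫⁻ b, g a b ∂μ ∂μ
  have hG : Measurable fun v : Fin n → α => g (v i) (v j) := by
    have h : Measurable fun v : Fin n → α => (v i, v j) :=
      (measurable_pi_apply i).prodMk (measurable_pi_apply j)
    exact hg.comp h
  have hpair : ∀ x : Fin n → α,
      lmarginal (fun _ : Fin n => μ) {i, j} (fun v : Fin n → α => g (v i) (v j)) x = K := by
    intro x
    rw [lmarginal_insert _ hG (Finset.notMem_singleton.2 hij), lmarginal_singleton]
    simp only [Function.update_self, Function.update_of_ne hij]
    rfl
  have hconst : ∀ x : Fin n → α,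
      lmarginal (fun _ : Fin n => μ) {i, j} (fun _ : Fin n → α => K) x = K := by
    intro x
    rw [lmarginal, lintegral_const, measure_univ, mul_one]
  calc ∫⁻ v, g (v i) (v j) ∂Measure.pi (fun _ : Fin n => μ)
      = ∫⁻ _v, K ∂Measure.pi (fun _ : Fin n => μ) :=
        lintegral_eq_of_lmarginal_eq {i, j} hG measurable_const
          (funext fun x => (hpair x).trans (hconst x).symm)
    _ = K := by rw [lintegral_const, measure_univ, mul_one]

/-! ### The two-coordinate identity -/

/-- **Exponential moment of the flux-tilted Maxwellian pair, two coordinates.**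
`∫∫ (ω·(a−b))₊ e^{c(|a|²+|b|²)} dγ_θ dγ_θ = (1 − 2cθ)^{-7/2} ∫∫ (ω·(a−b))₊ dγ_θ dγ_θ` (density rewrite on
each coordinate, then scaling `a ↦ (1−2cθ)^{-1/2} a` of both). [folklore] -/
theorem lintegral_tiltedPair_gaussMeasure {θ c : ℝ} (hθ : 0 < θ) (hcθ : c < 1 / (2 * θ)) (ω : V3) :
    ∫⁻ a, ∫⁻ b, ENNReal.ofReal (max ⟪ω, a - b⟫_ℝ 0 * Real.exp (c * (‖a‖ ^ 2 + ‖b‖ ^ 2)))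
        ∂gaussMeasure (0 : V3) θ ∂gaussMeasure (0 : V3) θ =
      ENNReal.ofReal ((1 - 2 * c * θ) ^ (-(7 : ℝ) / 2)) *
        ∫⁻ a, ∫⁻ b, ENNReal.ofReal (max ⟪ω, a - b⟫_ℝ 0)
          ∂gaussMeasure (0 : V3) θ ∂gaussMeasure (0 : V3) θ := by
  have hs : 0 < 1 - 2 * c * θ := one_sub_two_mul_tilt_pos hθ hcθ
  set s := 1 - 2 * c * θ
  set γ := gaussMeasure (0 : V3) θ
  set γ' := gaussMeasure (0 : V3) (θ / s)
  set e : V3 → ℝ≥0∞ := fun a => ENNReal.ofReal (Real.exp (c * ‖a‖ ^ 2)) with he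
  set Φ : V3 → V3 → ℝ≥0∞ := fun a b => ENNReal.ofReal (max ⟪ω, a - b⟫_ℝ 0) with hΦ
  have he_meas : Measurable e := by rw [he]; fun_prop
  have hΦ_meas : Measurable (Function.uncurry Φ) := by
    simp only [hΦ, Function.uncurry_def]
    exact (by fun_prop : Continuous fun p : V3 × V3 => max ⟪ω, p.1 - p.2⟫_ℝ 0).measurable.ennreal_ofReal
  have hΦa_meas : ∀ a, Measurable (Φ a) := fun a => hΦ_meas.of_uncurry_left
  have hA : γ.withDensity e = ENNReal.ofReal (s ^ (-(3 : ℝ) / 2)) • γ' :=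
    withDensity_exp_tilt_gaussMeasure hθ hcθ
  have hl : 0 < (Real.sqrt s)⁻¹ := inv_pos.2 (Real.sqrt_pos.2 hs)
  have hB : γ' = γ.map ⇑(MeasurableEquiv.smul₀ (Real.sqrt s)⁻¹ hl.ne') := by
    rw [MeasurableEquiv.coe_smul₀]
    exact gaussMeasure_div_eq_map_smul hs
  -- the integrand, factorised
  have hint : ∀ a b : V3, ENNReal.ofReal (max ⟪ω, a - b⟫_ℝ 0 * Real.exp (c * (‖a‖ ^ 2 + ‖b‖ ^ 2))) =
      e b * (e a * Φ a b) := by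
    intro a b
    simp only [he, hΦ]
    rw [← ENNReal.ofReal_mul (Real.exp_nonneg _), ← ENNReal.ofReal_mul (Real.exp_nonneg _),
      mul_add, Real.exp_add]
    congr 1
    ring
  simp_rw [hint]
  -- inner integral: tilt the law of `b`
  have step1 : ∀ a, ∫⁻ b, e b * (e a * Φ a b) ∂γ =
      ENNReal.ofReal (s ^ (-(3 : ℝ) / 2)) * (e a * ∫⁻ b, Φ a b ∂γ') := by
    intro a
    rw [← lintegral_const_mul _ (hΦa_meas a), ← smul_eq_mul (ENNReal.ofReal (s ^ (-(3 : ℝ) / 2))),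
      ← lintegral_smul_measure, ← hA,
      lintegral_withDensity_eq_lintegral_mul₀ he_meas.aemeasurable
        ((hΦa_meas a).const_mul _).aemeasurable]
    rfl
  simp_rw [step1]
  rw [lintegral_const_mul' _ _ ENNReal.ofReal_ne_top]
  -- outer integral: tilt the law of `a`
  have step2 : ∫⁻ a, e a * ∫⁻ b, Φ a b ∂γ' ∂γ =
      ENNReal.ofReal (s ^ (-(3 : ℝ) / 2)) * ∫⁻ a, ∫⁻ b, Φ a b ∂γ' ∂γ' := by
    rw [← smul_eq_mul (ENNReal.ofReal (s ^ (-(3 : ℝ) / 2))), ← lintegral_smul_measure, ← hA,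
      lintegral_withDensity_eq_lintegral_mul₀ he_meas.aemeasurable
        (hΦ_meas.lintegral_prod_right).aemeasurable]
    rfl
  rw [step2]
  -- scaling of both coordinates
  have hscale : ∀ a b : V3, Φ ((Real.sqrt s)⁻¹ • a) ((Real.sqrt s)⁻¹ • b) =
      ENNReal.ofReal ((Real.sqrt s)⁻¹) * Φ a b := by
    intro a b
    simp only [hΦ]
    rw [← smul_sub, real_inner_smul_right, ← ENNReal.ofReal_mul hl.le, mul_max_of_nonneg _ _ hl.le,
      mul_zero]
  have step3 : ∫⁻ a, ∫⁻ b, Φ a b ∂γ' ∂γ' =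
      ENNReal.ofReal ((Real.sqrt s)⁻¹) * ∫⁻ a, ∫⁻ b, Φ a b ∂γ ∂γ := by
    rw [hB, lintegral_map_equiv]
    simp_rw [lintegral_map_equiv, MeasurableEquiv.coe_smul₀, hscale]
    simp_rw [lintegral_const_mul' _ _ ENNReal.ofReal_ne_top]
  rw [step3, ← mul_assoc, ← mul_assoc, ← ENNReal.ofReal_mul (Real.rpow_nonneg hs.le _),
    ← ENNReal.ofReal_mul (mul_nonneg (Real.rpow_nonneg hs.le _) (Real.rpow_nonneg hs.le _))]
  congr 2
  rw [Real.sqrt_eq_rpow, ← Real.rpow_neg hs.le, ← Real.rpow_add hs, ← Real.rpow_add hs]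
  norm_num

/-- **Registered stub `stub_tiltedPairExpMoment` (K1d of P4, line `KineticSlabSketch` of crux
`JParityClosure.OddContactSymmetry`).** Exponential moment of the flux-tilted Maxwellian pair on the
product Gaussian space: an exact scaling identity with constant `(1 − 2cθ)^{-7/2}` (reduction to the
two coordinates `i ≠ j`, `lintegral_pi_pair_iterated`, and `lintegral_tiltedPair_gaussMeasure`). [folklore] -/
theorem stub_tiltedPairExpMoment :
    ∀ {θ c : ℝ} (_hθ : 0 < θ) (_hc : 0 ≤ c) (_hcθ : c < 1 / (2 * θ)) {n : ℕ} {i j : Fin n} (_hij : i ≠ j) (ω : V3),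
    ∫⁻ v, ENNReal.ofReal (max ⟪ω, v i - v j⟫_ℝ 0 * Real.exp (c * (‖v i‖ ^ 2 + ‖v j‖ ^ 2)))
        ∂(Measure.pi fun _ : Fin n => gaussMeasure (0 : V3) θ) =
      ENNReal.ofReal ((1 - 2 * c * θ) ^ (-(7 : ℝ) / 2)) *
        ∫⁻ v, ENNReal.ofReal (max ⟪ω, v i - v j⟫_ℝ 0) ∂(Measure.pi fun _ : Fin n => gaussMeasure (0 : V3) θ) := by
  intro θ c hθ _hc hcθ n i j hij ω
  have h1 : Measurable fun p : V3 × V3 =>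
      ENNReal.ofReal (max ⟪ω, p.1 - p.2⟫_ℝ 0 * Real.exp (c * (‖p.1‖ ^ 2 + ‖p.2‖ ^ 2))) :=
    (by fun_prop : Continuous fun p : V3 × V3 =>
      max ⟪ω, p.1 - p.2⟫_ℝ 0 * Real.exp (c * (‖p.1‖ ^ 2 + ‖p.2‖ ^ 2))).measurable.ennreal_ofReal
  have h2 : Measurable fun p : V3 × V3 => ENNReal.ofReal (max ⟪ω, p.1 - p.2⟫_ℝ 0) :=
    (by fun_prop : Continuous fun p : V3 × V3 => max ⟪ω, p.1 - p.2⟫_ℝ 0).measurable.ennreal_ofReal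
  calc ∫⁻ v, ENNReal.ofReal (max ⟪ω, v i - v j⟫_ℝ 0 * Real.exp (c * (‖v i‖ ^ 2 + ‖v j‖ ^ 2)))
        ∂(Measure.pi fun _ : Fin n => gaussMeasure (0 : V3) θ)
      = ∫⁻ a, ∫⁻ b, ENNReal.ofReal (max ⟪ω, a - b⟫_ℝ 0 * Real.exp (c * (‖a‖ ^ 2 + ‖b‖ ^ 2)))
          ∂gaussMeasure (0 : V3) θ ∂gaussMeasure (0 : V3) θ :=
        lintegral_pi_pair_iterated (gaussMeasure (0 : V3) θ) hij
          (g := fun a b => ENNReal.ofReal (max ⟪ω, a - b⟫_ℝ 0 * Real.exp (c * (‖a‖ ^ 2 + ‖b‖ ^ 2)))) h1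
    _ = ENNReal.ofReal ((1 - 2 * c * θ) ^ (-(7 : ℝ) / 2)) *
          ∫⁻ a, ∫⁻ b, ENNReal.ofReal (max ⟪ω, a - b⟫_ℝ 0)
            ∂gaussMeasure (0 : V3) θ ∂gaussMeasure (0 : V3) θ :=
        lintegral_tiltedPair_gaussMeasure hθ hcθ ω
    _ = ENNReal.ofReal ((1 - 2 * c * θ) ^ (-(7 : ℝ) / 2)) *
          ∫⁻ v, ENNReal.ofReal (max ⟪ω, v i - v j⟫_ℝ 0)
            ∂(Measure.pi fun _ : Fin n => gaussMeasure (0 : V3) θ) := by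
        rw [lintegral_pi_pair_iterated (gaussMeasure (0 : V3) θ) hij
          (g := fun a b => ENNReal.ofReal (max ⟪ω, a - b⟫_ℝ 0)) h2]

end Summit.AtomisticToContinuum.HydrodynamicLimit.Theorems.OddContactSymmetryKineticSlab

end
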